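import Literature.NumberTheory.GaloisRepresentations.HeckeCharacterDictionary
import Literature.NumberTheory.GaloisRepresentations.HeckeCharacterFiniteIdeleValuesProofs
import Literature.NumberTheory.GaloisRepresentations.RayClassGroupModulusChange
import HarnessLib

/-!
# The ray-class value of a finite-order Hecke character on a principal ideal `(b)`, `b ≡ 1` off one
# prime `𝔭` of the modulus, is `χ_𝔭(b)⁻¹` (Neukirch VII (6.13); brick S6 of the odd-`p` theta partner)

Route `SignedLowerHalves`, child L `SmallImageLowerHalfBothSigns` (item stmt-BirchSwinnertonDyer-23599), line
proposal `rtt_w3`, stub K0₂@p `stub_heckeThetaPartner_ns` — brick S6 ("idelic evaluation") of the arithmetic half at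
an ODD prime (width seat `bsd-line-slh-p3-w3` gen 9; memo `Lines/birth_acns-MEMO-w3-g9.md`).  THEOREMS ONLY (no
definition, no named fact, no `sorry`); ROUTE-INDEPENDENT; pure Hecke-character bookkeeping.

Let `K` be a totally complex number field, `χ` a Hecke character of FINITE ORDER with module of definition
`(T, e)` (`HeckeCharacter.IsModulus`), `v ∈ T`, and `b ∈ 𝓞 K`, `b ≠ 0`, a unit at `v` with
`b ≡ 1 mod 𝔭_w^{e_w + 1}` for every `w ∈ T ∖ {v}`.  Then the value of the ray-class function
`𝔮 ↦ χ(ϖ_𝔮)` on the ideal `(b)` is the inverse of the `v`-component of `χ` at `b`: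

  `χ̃((b)) := ∏_{𝔮 ∣ b} χ(ϖ_𝔮)^{ord_𝔮 b} = χ_v(b)⁻¹`  (`idealPow_valueAtUniformizer_span_eq_inv`),

by Neukirch's decomposition of the principal idele `b` (tree `HeckeCharacter.map_principalIdele_eq`:
`χ((b)_∞) · ∏_{w ∈ S} χ(⟨b⟩_w) = 1`), with `χ((b)_∞) = 1` (finite order, no real place:
`map_infiniteIdeles_eq_one_of_pos`), `χ(⟨b⟩_w) = 1` for `w ∈ T ∖ {v}` (`IsModulus.map_localUnits_eq_one_of_mem`)
and `χ(⟨b⟩_w) = χ(ϖ_w)^{ord_w b}` off `T` (`IsUnramifiedAt.coe_map_localUnits_eq_zpow`).  This is the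
identity through which the matching condition of the Teichmüller twist at the inert prime `𝔭` of the dihedral
field reads the LOCAL component `χ_𝔭` (brick ORIENT-CFT `exists_heckeCharacter_localComponent_eq`).

BSD, crux L and the stub are NOT proved here.

References: J. Neukirch, *Algebraic Number Theory*, Ch. VII §6 (6.11)–(6.14), proof of (6.13); Ch. VI (1.9).
-/

set_option autoImplicit false
set_option linter.dupNamespace false

noncomputable section

open NumberField IsDedekindDomain IsDedekindDomain.HeightOneSpectrum
open scoped nonZeroDivisors

namespace Summit.BirchSwinnertonDyer.BirchSwinnertonDyer.Theorems.SmallImageLambdaLowerThreeNsThetaPartner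

open Literature.NumberTheory.GaloisRepresentations Literature.NumberTheory.GaloisRepresentations.HeckeCharacter
  Literature.NumberTheory

variable {K : Type} [Field K] [NumberField K]

/-- **`χ̃((b)) = χ_v(b)⁻¹`** for a finite-order Hecke character `χ` of a totally complex number field with module
of definition `(T, e)`, `v ∈ T`, and `b ≠ 0` in `𝓞 K` a unit at `v` with `b ≡ 1 mod 𝔭_w^{e_w+1}` for all
`w ∈ T ∖ {v}`; here `χ̃((b)) = ∏_{𝔮 ∣ b} χ(ϖ_𝔮)^{ord_𝔮 b}` (`LFunctions.idealPow` of the prime-value function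
`𝔮 ↦ χ(ϖ_𝔮)`) and `χ_v(b) = χ(⟨b⟩_v)`. [cite: NeukirchANT1999, Ch. VII §6 Prop. (6.13) (proof)] -/
theorem idealPow_valueAtUniformizer_span_eq_inv [IsTotallyComplex K] {χ : HeckeCharacter K}
    (hfin : χ.IsFiniteOrder) {T : Finset (HeightOneSpectrum (𝓞 K))} {e : HeightOneSpectrum (𝓞 K) → ℕ}
    (hmod : IsModulus χ T e) {v : HeightOneSpectrum (𝓞 K)} (hvT : v ∈ T) {b : 𝓞 K} (hb : b ≠ 0)
    (hbv : b ∉ v.asIdeal) (hbT : ∀ w ∈ T, w ≠ v → b - 1 ∈ w.asIdeal ^ (e w + 1)) :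
    LFunctions.idealPow K (fun w => χ.valueAtUniformizer w) (Ideal.span {b}) =
      (((χ (localUnits v (globalToLocalUnits v (Units.mk0 (b : K) (by exact_mod_cast hb)))))⁻¹ : ℂˣ) : ℂ) := by
  classical
  have hb' : (b : K) ≠ 0 := fun h => hb (by exact_mod_cast h)
  set bu : Kˣ := Units.mk0 (b : K) hb' with hbu
  -- `b` is prime to every place of `T`
  have hbT' : ∀ w ∈ T, b ∉ w.asIdeal := by
    intro w hw hbw
    by_cases hwv : w = v
    · exact hbv (hwv ▸ hbw)
    · have h1 : b - 1 ∈ w.asIdeal := Ideal.pow_le_self (Nat.succ_ne_zero _) (hbT w hw hwv)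
      have : (1 : 𝓞 K) ∈ w.asIdeal := by
        have := w.asIdeal.sub_mem hbw h1
        rwa [sub_sub_cancel] at this
      exact w.isPrime.ne_top ((Ideal.eq_top_iff_one _).mpr this)
  have hvalb : ∀ w ∈ T, w.valuation K (b : K) = 1 := fun w hw =>
    (valuation_eq_one_iff_notMem (K := K) w).mpr (hbT' w hw)
  -- the finite set `S ⊇ T` outside which `b` is a unit
  set S : Finset (HeightOneSpectrum (𝓞 K)) :=
    T ∪ (finite_setOf_valuation_coe_ne_one (K := K) hb).toFinset with hSdef
  have hTS : T ⊆ S := Finset.subset_union_left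
  have hSb : ∀ w ∉ S, w.valuation K (b : K) = 1 := fun w hw => by
    by_contra h
    exact hw (Finset.mem_union_right _ ((Set.Finite.mem_toFinset _).mpr h))
  -- Neukirch's decomposition for `b`
  have hB := map_principalIdele_eq hmod bu hTS hSb
  -- the infinite part is `1` (finite order, no real place)
  have hinf : χ (infiniteIdeles K (globalToInfiniteUnits K bu)) = 1 :=
    map_infiniteIdeles_eq_one_of_pos hfin bu fun φ => (not_nonempty_ringHom_real (K := K) φ).elim
  -- the part at `T ∖ {v}` is `1`
  have hTpart : ∀ w ∈ T, w ≠ v → χ (localUnits w (globalToLocalUnits w bu)) = 1 := by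
    intro w hw hwv
    refine IsModulus.map_localUnits_eq_one_of_mem hmod _ ?_ ?_
    · rw [val_globalToLocalUnits, valued_algebraMap_adicCompletion, hbu, Units.val_mk0]
      exact hvalb w hw
    · have hcast : (b : K) - 1 = algebraMap (𝓞 K) K (b - 1) := by rw [map_sub, map_one]
      rw [val_globalToLocalUnits, hbu, Units.val_mk0, ← map_one (algebraMap K (w.adicCompletion K)), ← map_sub,
        valued_algebraMap_adicCompletion, hcast, valuation_of_algebraMap]
      calc w.intValuation (b - 1) ≤ WithZero.exp (-((e w + 1 : ℕ) : ℤ)) :=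
            (intValuation_le_pow_iff_mem w (b - 1) (e w + 1)).mpr (hbT w hw hwv)
        _ ≤ WithZero.exp (-(e w : ℤ)) := WithZero.exp_le_exp.mpr (by push_cast; linarith)
  have hTprod : ∏ w ∈ T, χ (localUnits w (globalToLocalUnits w bu)) = χ (localUnits v (globalToLocalUnits v bu)) := by
    rw [← Finset.mul_prod_erase T _ hvT]
    rw [Finset.prod_eq_one fun w hw => hTpart w (Finset.mem_of_mem_erase hw) (Finset.ne_of_mem_erase hw), mul_one]
  -- the part off `T` in terms of `χ(ϖ_w)`
  have hval : ∀ w ∈ S \ T, (χ (localUnits w (globalToLocalUnits w bu)) : ℂ) =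
      χ.valueAtUniformizer w ^ (Associates.mk w.asIdeal).count
        (Associates.mk (Ideal.span {b} : Ideal (𝓞 K))).factors := by
    intro w hw
    have hwT : w ∉ T := (Finset.mem_sdiff.mp hw).2
    rw [(isUnramifiedAt_of_isModulus' hmod hwT).coe_map_localUnits_eq_zpow (globalToLocalUnits w bu)
      (m := ((Associates.mk w.asIdeal).count (Associates.mk (Ideal.span {b} : Ideal (𝓞 K))).factors : ℤ))
      (by rw [val_globalToLocalUnits, hbu, Units.val_mk0]; exact valued_coe_ringOfIntegers w hb), zpow_natCast]
  have hprod : LFunctions.idealPow K (fun w => χ.valueAtUniformizer w) (Ideal.span {b}) =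
      ((∏ w ∈ S \ T, χ (localUnits w (globalToLocalUnits w bu)) : ℂˣ) : ℂ) := by
    rw [Units.coe_prod, LFunctions.idealPow, finprod_eq_prod_of_mulSupport_subset _ (s := S \ T) ?_]
    · exact Finset.prod_congr rfl fun w hw => (hval w hw).symm
    · intro w hw
      rw [Function.mem_mulSupport] at hw
      have hcnt : (Associates.mk w.asIdeal).count
          (Associates.mk (Ideal.span {b} : Ideal (𝓞 K))).factors ≠ 0 := fun h0 => hw (by rw [h0, pow_zero])
      have hdvd : w.asIdeal ∣ Ideal.span {b} :=
        (Associates.count_ne_zero_iff_dvd ((Submodule.ne_bot_iff _).mpr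
          ⟨b, Ideal.mem_span_singleton_self b, hb⟩) w.irreducible).mp hcnt
      have hbw : b ∈ w.asIdeal := Ideal.dvd_span_singleton.mp hdvd
      rw [Finset.coe_sdiff, Set.mem_sdiff, Finset.mem_coe, Finset.mem_coe]
      refine ⟨?_, fun hwT => hbT' w hwT hbw⟩
      by_contra hwS
      have := hSb w hwS
      rw [valuation_eq_one_iff_notMem (K := K) w] at this
      exact this hbw
  -- assemble
  rw [← Finset.prod_sdiff hTS, hTprod, hinf, one_mul] at hB
  rw [hprod, eq_inv_of_mul_eq_one_left hB]

end Summit.BirchSwinnertonDyer.BirchSwinnertonDyer.Theorems.SmallImageLambdaLowerThreeNsThetaPartner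

end
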